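import Literature.NumberTheory.LFunctions.RayClassMeanValue
import Literature.NumberTheory.LFunctions.ClassGroupLogFreeSavingAllDegrees
import HarnessLib

/-!
# The size of the mean value constant `|G| · M` for a congruence class group `mod 𝔪` (log-free saving)

Topic `Literature/NumberTheory/LFunctions`, namespace `Literature.NumberTheory.LFunctions.AbelianDensity`.
Everything here is PROVED (one definition with body, theorems; no named facts).

The constant of `RayClassMeanValue.congruence_meanValue_primes_le` is `8π |G| M`,
`M = (κ_K(𝔪)/|G|)/V'_𝔪(z) + |D_z(𝔪)|² err_𝔪(log y − (m+1)/A) z` (`κ_K(𝔪) = κ_K φ(𝔪)/N𝔪`).  Combining the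
bounds of `RayClassSieveDensity` — `V_𝔪(z) ≤ e^{n_K} V'_𝔪(z)`, `V_𝔪(z) ≥ κ_K(𝔪)(log z − u₀ − (m+1)/A)/(4(m+1))`
when `err_𝔪(u₀) ≤ κ_K(𝔪)/2`, `e^{u₀+(m+1)/A} ≤ z`, and `|D_z(𝔪)| ≤ |D_z| ≤ z^{n_K+1}` — the factor `φ(𝔪)/N𝔪`
cancels and
* `card_mul_rayMeanValueConst_le` — `|G| M ≤ 4(m+1) e^{n_K}/(log z − u₀ − (m+1)/A) + |G| z^{2(n_K+1)} err_𝔪(log y − (m+1)/A) z`,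
  the saving `1/log z` of the log-free large sieve [ThornerZaman2017, Theorem 4.1, (4-4)];
* `rayBalancePoint` — `u₀ = (2/3) log(2 |d_K| N𝔪³√N𝔪 e^{2n_K} C/(3κ_K))` with `err_𝔪(u₀) = κ_K/(2N𝔪) ≤ κ_K(𝔪)/2`
  (`rayErr_rayBalancePoint`, `rayErr_rayBalancePoint_le`) and `u₀ ≤ 40(n+1)² log P` under the size hypotheses
  `|d_K|, N𝔪 ≤ P`, `κ_K ≥ 1/P`, `1 ≤ T' ≤ 2P`, for the wide kernel `A = (n+2)T'`, `m = n_K + 3`, `n_K ≤ n`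
  (`rayBalancePoint_wide_le_of_le`; Gallagher's condition `(m+1)T'² ≤ 3A²` holds in every degree);
* `raySecondary_wide_le_of_le` — the secondary term is `≤ e^{2n²+17n+30} P^{2n+12} N_X^{−1/(2n+4)}` once
  `z^{2n+4} ≤ N_X`, `|G| ≤ P`.

## References
* [ThornerZaman2017] J. Thorner, A. Zaman, *An explicit bound for the least prime ideal in the Chebotarev
  density theorem*, Algebra Number Theory 11 (2017), Theorem 4.1, (4-4).
* [Weiss1983] A. Weiss, *The least prime ideal*, J. reine angew. Math. 338 (1983), §1.
-/

noncomputable section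

open Complex Finset IsDedekindDomain NumberField Filter
open scoped Topology

namespace Literature.NumberTheory.LFunctions.AbelianDensity

open Literature.NumberTheory.LFunctions.WeissKernel Literature.NumberTheory.LFunctions.NumberField
  Literature.NumberTheory.Sieve.Squarefree Literature.NumberTheory.LFunctions.LogFreeDensity
open scoped nonZeroDivisors _root_.NumberField Classical

variable {K : Type*} [Field K] [NumberField K] {𝔪 : Ideal (𝓞 K)}

/-! ### `|G| M ≤ 4(m+1)e^{n_K}/(log z − u₀ − (m+1)/A) + secondary` -/

/-- `|D_z(𝔪)| ≤ z^{n_K+1}`. [cite: ThornerZaman2017, Theorem 4.1] -/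
theorem card_admissibleCoprime_le_pow {z : ℝ} (hz : 0 ≤ z) :
    ((admissibleCoprime K 𝔪 z).card : ℝ) ≤ z ^ (Module.finrank ℚ K + 1) :=
  le_trans (by exact_mod_cast card_le_card (admissibleCoprime_subset (K := K) (𝔪 := 𝔪) z))
    (card_admissible_le_pow hz)

/-- **`|G| M ≤ 4(m+1)e^{n_K}/(log z − u₀ − (m+1)/A) + |G| z^{2(n_K+1)} err_𝔪(log y − (m+1)/A) z`** for a
congruence class group of order `h = |G|` modulo `𝔪 ≠ 0`, whenever `err_𝔪(u₀) ≤ κ_K(𝔪)/2` and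
`1 ≤ log z − u₀ − (m+1)/A` (the factor `φ(𝔪)/N𝔪` of the main term cancels against `V_𝔪(z) ≫ κ_K(𝔪) log z`).
[cite: ThornerZaman2017, Theorem 4.1] -/
theorem card_mul_rayMeanValueConst_le (h𝔪 : 𝔪 ≠ ⊥) {A : ℝ} (hA : 0 < A) {m : ℕ} (hm : Module.finrank ℚ K + 3 ≤ m)
    {z : ℝ} (hz1 : 1 ≤ z) (y : ℝ) {u₀ : ℝ} (hu₀ : rayErr K 𝔪 A m u₀ ≤ coprimeResidue K 𝔪 h𝔪 / 2)
    (hzu : 1 ≤ Real.log z - u₀ - ((m : ℝ) + 1) / A) (h : ℕ) (hh : 0 < h) :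
    h * rayMeanValueConst K 𝔪 h𝔪 h A m z y ≤
      4 * ((m : ℝ) + 1) * Real.exp (Module.finrank ℚ K) / (Real.log z - u₀ - ((m : ℝ) + 1) / A) +
        h * z ^ (2 * (Module.finrank ℚ K + 1)) * (rayErr K 𝔪 A m (Real.log y - ((m : ℝ) + 1) / A) * z) := by
  set κ := coprimeResidue K 𝔪 h𝔪 with hκ
  set n : ℕ := Module.finrank ℚ K with hn
  set L : ℝ := Real.log z - u₀ - ((m : ℝ) + 1) / A with hL
  set Vp : ℝ := bigV (fun v : HeightOneSpectrum (𝓞 K) ↦ (Ideal.absNorm v.asIdeal : ℝ)) (admissibleCoprime K 𝔪 z)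
    with hVp
  set V : ℝ := ∑ I ∈ (idealsNormLE K ⌊z⌋₊).filter (fun I ↦ IsCoprime I 𝔪), ((Ideal.absNorm I : ℕ) : ℝ)⁻¹ with hV
  have hκ0 : 0 < κ := coprimeResidue_pos h𝔪
  have hh0 : (0 : ℝ) < h := by exact_mod_cast hh
  have hz0 : 0 ≤ z := by linarith
  have hN : ∀ v : HeightOneSpectrum (𝓞 K), 1 < (Ideal.absNorm v.asIdeal : ℝ) := one_lt_absNorm_real
  have hVp0 : 0 < Vp := bigV_pos hN ⟨∅, empty_mem_admissibleCoprime (K := K) (𝔪 := 𝔪) hz1⟩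
  have hzexp : Real.exp (u₀ + ((m : ℝ) + 1) / A) ≤ z := by
    have hz0' : 0 < z := by linarith
    rw [← Real.exp_log hz0']
    exact Real.exp_le_exp.mpr (by linarith)
  have hVlow : κ * L / (4 * ((m : ℝ) + 1)) ≤ V := coprimeResidue_mul_log_le_sum_inv h𝔪 hA hm hu₀ hzexp
  have hVup : V ≤ Real.exp n * Vp := by
    have := sum_coprime_inv_le (K := K) (𝔪 := 𝔪) hz0
    rw [hV]; convert this using 2
  have hL0 : 0 < L := by linarith
  have hV0 : 0 < V := lt_of_lt_of_le (by positivity) hVlow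
  have hmain : (h : ℝ) * ((κ / h) / Vp) ≤ 4 * ((m : ℝ) + 1) * Real.exp n / L := by
    have e1 : (h : ℝ) * ((κ / h) / Vp) = κ / Vp := by field_simp
    rw [e1, div_le_div_iff₀ hVp0 hL0]
    have h1 : κ * L ≤ 4 * ((m : ℝ) + 1) * V := by
      rw [div_le_iff₀ (by positivity)] at hVlow; linarith
    have h2 : 4 * ((m : ℝ) + 1) * V ≤ 4 * ((m : ℝ) + 1) * (Real.exp n * Vp) :=
      mul_le_mul_of_nonneg_left hVup (by positivity)
    nlinarith
  have herr0 : 0 ≤ rayErr K 𝔪 A m (Real.log y - ((m : ℝ) + 1) / A) * z :=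
    mul_nonneg (rayErr_nonneg 𝔪 A m _) hz0
  have hD : ((admissibleCoprime K 𝔪 z).card : ℝ) ^ 2 ≤ z ^ (2 * (n + 1)) := by
    rw [pow_mul']
    exact pow_le_pow_left₀ (Nat.cast_nonneg _) (card_admissibleCoprime_le_pow hz0) 2
  rw [rayMeanValueConst, mul_add, ← hVp]
  refine add_le_add hmain ?_
  rw [← mul_assoc]
  refine mul_le_mul_of_nonneg_right ?_ herr0
  exact mul_le_mul_of_nonneg_left hD hh0.le

/-! ### The balancing point -/

variable (K) in
/-- The balancing point `u₀ = (2/3) log(2 |d_K| N𝔪³ √N𝔪 e^{2n_K} C/(3κ_K))` (`C = majorConst A m (n_K+1)`), at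
which `err_𝔪(u₀) = κ_K/(2N𝔪)`. [cite: ThornerZaman2017, Theorem 4.1] -/
def rayBalancePoint (𝔪 : Ideal (𝓞 K)) (A : ℝ) (m : ℕ) : ℝ :=
  2 / 3 * Real.log (2 * (((NumberField.discr K).natAbs : ℝ) * ((Ideal.absNorm 𝔪 : ℕ) : ℝ) ^ 2 *
    Real.sqrt (Ideal.absNorm 𝔪 : ℕ)) * Real.exp (2 * Module.finrank ℚ K) * majorConst A m (Module.finrank ℚ K + 1) *
      ((Ideal.absNorm 𝔪 : ℕ) : ℝ) / (3 * dedekindZeta_residue K))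

/-- **`err_𝔪(u₀) = κ_K/(2 N𝔪)`** at the balancing point. [cite: ThornerZaman2017, Theorem 4.1] -/
theorem rayErr_rayBalancePoint (h𝔪 : 𝔪 ≠ ⊥) (A : ℝ) (m : ℕ) :
    rayErr K 𝔪 A m (rayBalancePoint K 𝔪 A m) = dedekindZeta_residue K / (2 * (Ideal.absNorm 𝔪 : ℕ)) := by
  set κ := dedekindZeta_residue K with hκ
  set C := majorConst A m (Module.finrank ℚ K + 1) with hC
  set d : ℝ := ((NumberField.discr K).natAbs : ℝ) with hd
  set E := Real.exp (2 * Module.finrank ℚ K) with hE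
  have hκ0 : 0 < κ := dedekindZeta_residue_pos K
  have hC0 : 0 < C := majorConst_pos A m _
  have hd0 : 0 < d := by rw [hd]; exact_mod_cast Int.natAbs_pos.mpr (NumberField.discr_ne_zero K)
  have hE0 : 0 < E := Real.exp_pos _
  have hN0 : (0 : ℝ) < ((Ideal.absNorm 𝔪 : ℕ) : ℝ) := by
    exact_mod_cast Nat.pos_of_ne_zero (by rwa [Ne, Ideal.absNorm_eq_zero_iff])
  have hS0 : 0 < Real.sqrt (Ideal.absNorm 𝔪 : ℕ) := Real.sqrt_pos.mpr hN0
  set X : ℝ := 2 * (d * ((Ideal.absNorm 𝔪 : ℕ) : ℝ) ^ 2 * Real.sqrt (Ideal.absNorm 𝔪 : ℕ)) * E * C *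
    ((Ideal.absNorm 𝔪 : ℕ) : ℝ) / (3 * κ) with hX
  have hX0 : 0 < X := by positivity
  have hexp : Real.exp (-(3 / 2 * (2 / 3 * Real.log X))) = X⁻¹ := by
    rw [show -(3 / 2 * (2 / 3 * Real.log X)) = -Real.log X by ring, Real.exp_neg, Real.exp_log hX0]
  rw [rayErr, rayBalancePoint, ← hd, ← hE, ← hC, ← hκ, ← hX, hexp, hX]
  field_simp

/-- **`err_𝔪(u₀) ≤ κ_K(𝔪)/2`** at the balancing point (`κ_K(𝔪) ≥ κ_K/N𝔪`). [cite: ThornerZaman2017, Theorem 4.1] -/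
theorem rayErr_rayBalancePoint_le (h𝔪 : 𝔪 ≠ ⊥) (A : ℝ) (m : ℕ) :
    rayErr K 𝔪 A m (rayBalancePoint K 𝔪 A m) ≤ coprimeResidue K 𝔪 h𝔪 / 2 := by
  rw [rayErr_rayBalancePoint h𝔪]
  have := residue_div_le_coprimeResidue (K := K) h𝔪
  have hN0 : (0 : ℝ) < (Ideal.absNorm 𝔪 : ℕ) := by
    exact_mod_cast Nat.pos_of_ne_zero (by rwa [Ne, Ideal.absNorm_eq_zero_iff])
  rw [mul_comm, ← div_div]
  linarith

/-- **`u₀ ≤ 40(n+1)² log P`** for the wide kernel (`A = (n+2)T'`, `m = n_K + 3`, `n_K ≤ n`, `1 ≤ T' ≤ 2P`,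
`|d_K| ≤ P`, `N𝔪 ≤ P`, `P⁻¹ ≤ κ_K`, `P ≥ 2`). [cite: ThornerZaman2017, Theorem 4.1] -/
theorem rayBalancePoint_wide_le_of_le (h𝔪 : 𝔪 ≠ ⊥) {n : ℕ} (hn : Module.finrank ℚ K ≤ n) {P T' : ℝ} (hP : 2 ≤ P)
    (hT : 1 ≤ T') (hT2 : T' ≤ 2 * P)
    (hd : ((NumberField.discr K).natAbs : ℝ) ≤ P) (hN𝔪 : ((Ideal.absNorm 𝔪 : ℕ) : ℝ) ≤ P)
    (hκ : P⁻¹ ≤ dedekindZeta_residue K) :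
    rayBalancePoint K 𝔪 (((n : ℝ) + 2) * T') (Module.finrank ℚ K + 3) ≤ 40 * ((n : ℝ) + 1) ^ 2 * Real.log P := by
  set nK : ℕ := Module.finrank ℚ K with hn'
  set κ := dedekindZeta_residue K with hκ'
  set C := majorConst (((n : ℝ) + 2) * T') (nK + 3) (nK + 1) with hC
  set d : ℝ := ((NumberField.discr K).natAbs : ℝ) with hd'
  set N : ℝ := ((Ideal.absNorm 𝔪 : ℕ) : ℝ) with hN
  have hP0 : 0 < P := by linarith
  have hP1 : 1 ≤ P := by linarith
  have hLp : Real.log 2 ≤ Real.log P := Real.log_le_log (by norm_num) hP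
  have hl2 : (0.69 : ℝ) ≤ Real.log 2 := by have := Real.log_two_gt_d9; linarith
  have hl2' : Real.log 2 ≤ 0.7 := by have := Real.log_two_lt_d9; linarith
  have hLp0 : 0 < Real.log P := by linarith
  have hκ0 : 0 < κ := dedekindZeta_residue_pos K
  have hC1 : 0 < C := majorConst_pos _ _ _
  have hd1 : (1 : ℝ) ≤ d := by rw [hd']; exact_mod_cast Int.natAbs_pos.mpr (NumberField.discr_ne_zero K)
  have hN1 : (1 : ℝ) ≤ N := by
    rw [hN]; exact_mod_cast Nat.one_le_iff_ne_zero.mpr (by rwa [Ne, Ideal.absNorm_eq_zero_iff])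
  have hN0 : 0 < N := by linarith
  have hsqrt : Real.sqrt (Ideal.absNorm 𝔪 : ℕ) ≤ P := by
    rw [← hN]
    calc Real.sqrt N ≤ N := by
          rw [Real.sqrt_le_left (by linarith)]; nlinarith
      _ ≤ P := hN𝔪
  have hsqrt0 : 0 < Real.sqrt (Ideal.absNorm 𝔪 : ℕ) := Real.sqrt_pos.mpr (by rw [← hN]; exact hN0)
  have hnr : (nK : ℝ) ≤ n := by exact_mod_cast hn
  have hn0 : (0 : ℝ) ≤ n := Nat.cast_nonneg n
  have hCle : C ≤ Real.exp (2 * n ^ 2 + 13 * n + 20) * T' ^ (2 * n + 7) := majorConst_wide_le_of_le hn hT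
  set X : ℝ := 2 * (d * N ^ 2 * Real.sqrt (Ideal.absNorm 𝔪 : ℕ)) * Real.exp (2 * nK) * C * N / (3 * κ) with hX
  have hX0 : 0 < X := by positivity
  have hinvκ : κ⁻¹ ≤ P := inv_le_of_inv_le₀ hP0 hκ
  have hE : Real.exp (2 * (nK : ℝ)) ≤ Real.exp (2 * n) := Real.exp_le_exp.mpr (by linarith)
  have hTpow : T' ^ (2 * n + 7) ≤ (2 * P) ^ (2 * n + 7) := pow_le_pow_left₀ (by linarith) hT2 _
  have hXle : X ≤ Real.exp (2 * n ^ 2 + 15 * n + 20) * (2 : ℝ) ^ (2 * n + 7) * P ^ (2 * n + 13) := by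
    have hXeq : X = 2 * (d * N ^ 2 * Real.sqrt (Ideal.absNorm 𝔪 : ℕ)) * Real.exp (2 * nK) * C * N / 3 * κ⁻¹ := by
      rw [hX]; field_simp
    rw [hXeq]
    have h3 : 2 * (d * N ^ 2 * Real.sqrt (Ideal.absNorm 𝔪 : ℕ)) * Real.exp (2 * nK) * C * N / 3 ≤
        (d * N ^ 2 * Real.sqrt (Ideal.absNorm 𝔪 : ℕ)) * Real.exp (2 * nK) * C * N := by
      have : 0 ≤ (d * N ^ 2 * Real.sqrt (Ideal.absNorm 𝔪 : ℕ)) * Real.exp (2 * nK) * C * N := by positivity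
      linarith
    calc 2 * (d * N ^ 2 * Real.sqrt (Ideal.absNorm 𝔪 : ℕ)) * Real.exp (2 * nK) * C * N / 3 * κ⁻¹
        ≤ ((d * N ^ 2 * Real.sqrt (Ideal.absNorm 𝔪 : ℕ)) * Real.exp (2 * nK) * C * N) * P :=
          mul_le_mul h3 hinvκ (inv_nonneg.mpr hκ0.le) (by positivity)
      _ ≤ ((P * P ^ 2 * P) * Real.exp (2 * n) * (Real.exp (2 * n ^ 2 + 13 * n + 20) * (2 * P) ^ (2 * n + 7)) * P) * P := by
          gcongr
          exact hCle.trans (mul_le_mul_of_nonneg_left hTpow (by positivity))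
      _ = Real.exp (2 * n ^ 2 + 15 * n + 20) * 2 ^ (2 * n + 7) * P ^ (2 * n + 13) := by
          have hexp : Real.exp (2 * n ^ 2 + 15 * n + 20) = Real.exp (2 * n) * Real.exp (2 * n ^ 2 + 13 * n + 20) := by
            rw [← Real.exp_add]; congr 1; ring
          rw [mul_pow, hexp]; ring
  have hlogX : Real.log X ≤ (2 * n ^ 2 + 15 * n + 20) + (2 * n + 7) * Real.log 2 + (2 * n + 13) * Real.log P := by
    have h1 := Real.log_le_log hX0 hXle
    rw [Real.log_mul (by positivity) (by positivity), Real.log_mul (by positivity) (by positivity),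
      Real.log_exp, Real.log_pow, Real.log_pow] at h1
    push_cast at h1
    linarith
  rw [rayBalancePoint, ← hn', ← hd', ← hC, ← hκ', ← hN, ← hX]
  have hA : (2 * (n : ℝ) ^ 2 + 15 * n + 20) * 0.69 ≤ (2 * (n : ℝ) ^ 2 + 15 * n + 20) * Real.log P :=
    mul_le_mul_of_nonneg_left (by linarith) (by positivity)
  have hB : (2 * (n : ℝ) + 7) * Real.log 2 ≤ (2 * (n : ℝ) + 7) * Real.log P :=
    mul_le_mul_of_nonneg_left hLp (by positivity)
  have hnLp0 : 0 ≤ (n : ℝ) * Real.log P := by positivity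
  have hn2Lp0 : 0 ≤ (n : ℝ) ^ 2 * Real.log P := by positivity
  linarith

/-! ### The secondary term -/

/-- **The secondary term for the wide kernel is `≤ e^{2n²+17n+30} P^{2n+12} N_X^{−1/(2n+4)}`** once `z^{2n+4} ≤ N_X`,
`1 ≤ N_X` (size hypotheses `|d_K|, N𝔪, |G| ≤ P`, `1 ≤ T' ≤ 2P`, `A = (n+2)T'`, `m = n_K + 3`, `n_K ≤ n`).
[cite: ThornerZaman2017, Theorem 4.1] -/
theorem raySecondary_wide_le_of_le {n : ℕ} (hn : Module.finrank ℚ K ≤ n) {P T' : ℝ} (hP : 2 ≤ P) (hT : 1 ≤ T')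
    (hT2 : T' ≤ 2 * P) (hd : ((NumberField.discr K).natAbs : ℝ) ≤ P) (hN𝔪 : ((Ideal.absNorm 𝔪 : ℕ) : ℝ) ≤ P)
    (h𝔪 : 𝔪 ≠ ⊥) {h : ℕ} (hh : (h : ℝ) ≤ P)
    {z NX : ℝ} (hz0 : 0 ≤ z) (hzE : z ^ (2 * n + 4) ≤ NX) (hNX : 1 ≤ NX) :
    h * z ^ (2 * (Module.finrank ℚ K + 1)) *
        (rayErr K 𝔪 (((n : ℝ) + 2) * T') (Module.finrank ℚ K + 3)
          (Real.log NX - (((Module.finrank ℚ K + 3 : ℕ) : ℝ) + 1) / (((n : ℝ) + 2) * T')) * z) ≤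
      Real.exp (2 * n ^ 2 + 17 * n + 30) * P ^ (2 * n + 12) * (NX ^ (1 / (2 * (n : ℝ) + 4)))⁻¹ := by
  set nK : ℕ := Module.finrank ℚ K with hn'
  set C := majorConst (((n : ℝ) + 2) * T') (nK + 3) (nK + 1) with hC
  set d : ℝ := ((NumberField.discr K).natAbs : ℝ) with hd'
  set N : ℝ := ((Ideal.absNorm 𝔪 : ℕ) : ℝ) with hN
  have hP0 : 0 < P := by linarith
  have hP1 : 1 ≤ P := by linarith
  have hNX0 : 0 < NX := lt_of_lt_of_le one_pos hNX
  have hh0 : (0 : ℝ) ≤ h := Nat.cast_nonneg _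
  have hd0 : 0 ≤ d := Nat.cast_nonneg _
  have hC0 : 0 < C := majorConst_pos _ _ _
  have hN1 : (1 : ℝ) ≤ N := by
    rw [hN]; exact_mod_cast Nat.one_le_iff_ne_zero.mpr (by rwa [Ne, Ideal.absNorm_eq_zero_iff])
  have hsqrt : Real.sqrt (Ideal.absNorm 𝔪 : ℕ) ≤ P := by
    rw [← hN]
    calc Real.sqrt N ≤ N := by rw [Real.sqrt_le_left (by linarith)]; nlinarith
      _ ≤ P := hN𝔪
  have hnr : (nK : ℝ) ≤ n := by exact_mod_cast hn
  have hn0 : (0 : ℝ) ≤ n := Nat.cast_nonneg n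
  have hCle : C ≤ Real.exp (2 * n ^ 2 + 13 * n + 20) * T' ^ (2 * n + 7) := majorConst_wide_le_of_le hn hT
  have hE0 : (0 : ℝ) < 2 * (n : ℝ) + 4 := by positivity
  have hA0 : 0 < ((n : ℝ) + 2) * T' := by positivity
  set w : ℝ := NX ^ (1 / (2 * (n : ℝ) + 4)) with hw
  have hw0 : 0 < w := Real.rpow_pos_of_pos hNX0 _
  have hwE : w ^ (2 * n + 4) = NX := by
    rw [hw, ← Real.rpow_natCast, ← Real.rpow_mul hNX0.le]
    have hcast : 1 / (2 * (n : ℝ) + 4) * ((2 * n + 4 : ℕ) : ℝ) = 1 := by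
      push_cast; rw [one_div, inv_mul_cancel₀ hE0.ne']
    rw [hcast, Real.rpow_one]
  have hzw : z ≤ w := by
    have : z ^ (2 * n + 4) ≤ w ^ (2 * n + 4) := by rw [hwE]; exact hzE
    exact le_of_pow_le_pow_left₀ (by omega) hw0.le this
  have h1w : 1 ≤ w := by
    have : (1 : ℝ) ^ (2 * n + 4) ≤ w ^ (2 * n + 4) := by rw [hwE, one_pow]; exact hNX
    exact le_of_pow_le_pow_left₀ (by omega) hw0.le this
  have hu : Real.exp (-(3 / 2 * (Real.log NX - (((nK + 3 : ℕ) : ℝ) + 1) / (((n : ℝ) + 2) * T')))) ≤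
      Real.exp 3 * (w ^ (3 * n + 6))⁻¹ := by
    have hsplit : -(3 / 2 * (Real.log NX - (((nK + 3 : ℕ) : ℝ) + 1) / (((n : ℝ) + 2) * T'))) =
        3 / 2 * ((((nK + 3 : ℕ) : ℝ) + 1) / (((n : ℝ) + 2) * T')) + (-(3 / 2) * Real.log NX) := by ring
    rw [hsplit, Real.exp_add]
    have h1 : Real.exp (3 / 2 * ((((nK + 3 : ℕ) : ℝ) + 1) / (((n : ℝ) + 2) * T'))) ≤ Real.exp 3 := by
      refine Real.exp_le_exp.mpr ?_
      have : (((nK + 3 : ℕ) : ℝ) + 1) / (((n : ℝ) + 2) * T') ≤ 2 := by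
        rw [div_le_iff₀ hA0]; push_cast
        have : 0 ≤ ((n : ℝ) + 2) * (T' - 1) := mul_nonneg (by positivity) (by linarith)
        linarith
      linarith
    have h2 : Real.exp (-(3 / 2) * Real.log NX) = (w ^ (3 * n + 6))⁻¹ := by
      rw [show -(3 / 2) * Real.log NX = Real.log NX * (-(3 / 2)) by ring, ← Real.rpow_def_of_pos hNX0, hw,
        ← Real.rpow_natCast, ← Real.rpow_mul hNX0.le, ← Real.rpow_neg hNX0.le]
      congr 1
      push_cast
      field_simp
      ring
    rw [h2]
    exact mul_le_mul_of_nonneg_right h1 (by positivity)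
  have hz : z ^ (2 * (nK + 1)) * z ≤ w ^ (2 * n + 3) := by
    rw [← pow_succ]
    calc z ^ (2 * (nK + 1) + 1) ≤ w ^ (2 * (nK + 1) + 1) := pow_le_pow_left₀ hz0 hzw _
      _ ≤ w ^ (2 * n + 3) := pow_le_pow_right₀ h1w (by omega)
  have hkey : Real.exp (-(3 / 2 * (Real.log NX - (((nK + 3 : ℕ) : ℝ) + 1) / (((n : ℝ) + 2) * T')))) *
      (z ^ (2 * (nK + 1)) * z) ≤ Real.exp 3 * w⁻¹ := by
    have hsplit : w ^ (3 * n + 6) = w ^ (2 * n + 3) * w ^ (n + 3) := by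
      rw [← pow_add]; congr 1; ring
    calc Real.exp (-(3 / 2 * (Real.log NX - (((nK + 3 : ℕ) : ℝ) + 1) / (((n : ℝ) + 2) * T')))) * (z ^ (2 * (nK + 1)) * z)
        ≤ (Real.exp 3 * (w ^ (3 * n + 6))⁻¹) * w ^ (2 * n + 3) :=
          mul_le_mul hu hz (by positivity) (by positivity)
      _ = Real.exp 3 * (w ^ (n + 3))⁻¹ := by
          rw [hsplit]; field_simp
      _ ≤ Real.exp 3 * w⁻¹ := by
          refine mul_le_mul_of_nonneg_left ?_ (by positivity)
          exact inv_anti₀ hw0 (le_self_pow₀ h1w (by omega))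
  have hE : Real.exp (2 * (nK : ℝ)) ≤ Real.exp (2 * n) := Real.exp_le_exp.mpr (by linarith)
  have hTpow : T' ^ (2 * n + 7) ≤ (2 * P) ^ (2 * n + 7) := pow_le_pow_left₀ (by linarith) hT2 _
  have h2pow : (2 : ℝ) ^ (2 * n + 7) ≤ Real.exp ((2 * n + 7 : ℕ) : ℝ) := by
    have := pow_le_exp_mul (c := 2) (m := 1) (by norm_num) (by norm_num) (2 * n + 7)
    simpa using this
  rw [rayErr, ← hd', ← hC, ← hN]
  calc (h : ℝ) * z ^ (2 * (nK + 1)) *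
        (1 / 3 * ((d * N ^ 2 * Real.sqrt (Ideal.absNorm 𝔪 : ℕ)) * Real.exp (2 * nK)) * C *
          Real.exp (-(3 / 2 * (Real.log NX - (((nK + 3 : ℕ) : ℝ) + 1) / (((n : ℝ) + 2) * T')))) * z)
      = 1 / 3 * (h * (d * N ^ 2 * Real.sqrt (Ideal.absNorm 𝔪 : ℕ)) * Real.exp (2 * nK) * C) *
          (Real.exp (-(3 / 2 * (Real.log NX - (((nK + 3 : ℕ) : ℝ) + 1) / (((n : ℝ) + 2) * T')))) *
            (z ^ (2 * (nK + 1)) * z)) := by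
        ring
    _ ≤ 1 / 3 * (P * (P * P ^ 2 * P) * Real.exp (2 * n) * (Real.exp (2 * n ^ 2 + 13 * n + 20) * (2 * P) ^ (2 * n + 7))) *
          (Real.exp 3 * w⁻¹) := by
        gcongr
        exact hCle.trans (mul_le_mul_of_nonneg_left hTpow (by positivity))
    _ = (1 / 3 * 2 ^ (2 * n + 7)) * (Real.exp (2 * n) * Real.exp (2 * n ^ 2 + 13 * n + 20) * Real.exp 3) *
          P ^ (2 * n + 12) * w⁻¹ := by
        rw [mul_pow]; ring
    _ ≤ (1 * Real.exp ((2 * n + 7 : ℕ) : ℝ)) * (Real.exp (2 * n) * Real.exp (2 * n ^ 2 + 13 * n + 20) * Real.exp 3) *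
          P ^ (2 * n + 12) * w⁻¹ := by
        have HH : 1 / 3 * (2 : ℝ) ^ (2 * n + 7) ≤ 1 * Real.exp ((2 * n + 7 : ℕ) : ℝ) :=
          mul_le_mul (by norm_num) h2pow (by positivity) (by norm_num)
        exact mul_le_mul_of_nonneg_right (mul_le_mul_of_nonneg_right
          (mul_le_mul_of_nonneg_right HH (by positivity)) (by positivity)) (by positivity)
    _ = Real.exp (2 * n ^ 2 + 17 * n + 30) * P ^ (2 * n + 12) * w⁻¹ := by
        have hexp : Real.exp ((2 * n + 7 : ℕ) : ℝ) * (Real.exp (2 * n) * Real.exp (2 * n ^ 2 + 13 * n + 20) * Real.exp 3) =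
            Real.exp (2 * n ^ 2 + 17 * n + 30) := by
          rw [← Real.exp_add, ← Real.exp_add, ← Real.exp_add]
          congr 1
          push_cast
          ring
        rw [one_mul, hexp]

end Literature.NumberTheory.LFunctions.AbelianDensity

end
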